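import Mathlib
import HarnessLib

/-!
# The coaction of a grading and homogeneity of extended ideals

Topic: `Summits/ResolutionOfSingularities/ResolutionOfSingularities/Theorems`. Commutative algebra
serving the stub `stub_centre_isHomogeneous` of the line `Sketch` of the crux
`Theses.WeightedInvariant.DatumToEmbedded` (statement `stmt-ResolutionOfSingularities-0572`):
the graded encoding of a torus action (companion file
`WeightedInvariantDatumToEmbeddedCentreHomogeneous.lean` does the scheme theory).

Let `A` be a commutative ring graded (`GradedRing 𝒜`) by an abelian group `M`, and let
`A[M] = AddMonoidAlgebra A M` be the group algebra (for `M = ℤʲ` the Laurent polynomial ring in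
`j` variables over `A`, the coordinate ring of `𝔾ₘʲ × Spec A` over `Spec A`). The grading is the
same thing as the **coaction** `ρ : A → A[M]`, `a ↦ Σ_χ a_χ [χ]`, a ring map
(`exists_coaction`); the inclusion `ι₀ = singleZeroRingHom : A → A[M]` is the projection
`𝔾ₘʲ × Spec A → Spec A`. We prove:

* `coeff_coaction`: the coefficients of `ρ a` are the homogeneous components of `a`;
* `coeff_mem_of_mem_map` / `mem_map_of_coeff_mem`: `x ∈ J · A[M]` iff all coefficients of `x`
  lie in `J` (`A[M]` is free over `A` on the monomials);
* `map_coaction_eq_of_isHomogeneous`: a homogeneous ideal `J` has `ρ(J) · A[M] = J · A[M]`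
  (the closed subscheme `V(J)` is torus-stable), and conversely
  `isHomogeneous_of_map_coaction_le`: `ρ(J) · A[M] ≤ J · A[M]` forces `J` to be homogeneous
  (compare coefficients);
* `smooth_addMonoidAlgebra_pi`: `A[ℤʲ]` is a smooth `A`-algebra (iterated Laurent polynomial
  rings, each a localisation of a polynomial ring), and `smooth_coaction`: `ρ` is a smooth ring
  map, being `ι₀` followed by the shear automorphism `a [χ] ↦ ρ(a) [χ]` of `A[M]` (inverse: the
  shear by the antipode-twisted coaction `a ↦ Σ a_χ [-χ]`, `exists_ringEquiv_comp_eq_coaction`).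

Only Mathlib is used; there are no definitions (the coaction is produced existentially and used
through its characterisation `ρ a = a [i]` for `a ∈ 𝒜 i`).
-/

-- the summit namespace repeats `ResolutionOfSingularities` by design (mandated namespace)
set_option linter.dupNamespace false

namespace Summit.ResolutionOfSingularities.ResolutionOfSingularities.Theorems.DatumToEmbedded.CentreHomogeneous

open DirectSum AddMonoidAlgebra

/-! ## The coaction of a grading -/

section MonoidAlgebra

variable {M A : Type*} [AddCommGroup M] [CommRing A]

/-- `singleZeroRingHom a = a [0]` (Mathlib's `simps` lemma goes through `singleAddHom`).
[folklore] -/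
theorem singleZeroRingHom_eq (a : A) : (singleZeroRingHom a : A[M]) = single 0 a := rfl

/-- `Σᵢ (fᵢ [0]) = (Σᵢ fᵢ) [0]` in `A[M]`. [folklore] -/
theorem sum_single_zero {ι : Type*} (s : Finset ι) (f : ι → A) :
    ∑ i ∈ s, (single 0 (f i) : A[M]) = single 0 (∑ i ∈ s, f i) := by
  simpa only [singleAddHom_apply] using (map_sum (singleAddHom (0 : M) : A →+ A[M]) f s).symm

/-- **Coefficients of an element of an extended ideal**: if `x ∈ J · A[M]` (extension of
`J ≤ A` along `ι₀ : A → A[M]`), every coefficient of `x` lies in `J`. [folklore] -/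
theorem coeff_mem_of_mem_map [DecidableEq M] {J : Ideal A} {x : A[M]}
    (hx : x ∈ J.map (singleZeroRingHom : A →+* A[M])) (m : M) : x.coeff m ∈ J := by
  induction hx using Submodule.span_induction generalizing m with
  | mem x h =>
    obtain ⟨a, ha, rfl⟩ := h
    rw [singleZeroRingHom_eq, coeff_single, Finsupp.single_apply]
    split_ifs
    · exact ha
    · exact J.zero_mem
  | zero => simp
  | add x y _ _ hx hy => simpa [coeff_add] using J.add_mem (hx m) (hy m)
  | smul x y _ hy =>
    rw [smul_eq_mul, coeff_mul]
    refine J.sum_mem fun a _ => J.sum_mem fun b _ => ?_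
    dsimp only
    split_ifs
    · exact J.mul_mem_left _ (hy b)
    · exact J.zero_mem

/-- Conversely, an element of `A[M]` all of whose coefficients lie in `J` lies in `J · A[M]`.
[folklore] -/
theorem mem_map_of_coeff_mem {J : Ideal A} {x : A[M]} (hx : ∀ m, x.coeff m ∈ J) :
    x ∈ J.map (singleZeroRingHom : A →+* A[M]) := by
  rw [← sum_coeff_single x]
  refine Ideal.sum_mem _ fun m _ => ?_
  have : single m (x.coeff m) = single m 1 * singleZeroRingHom (x.coeff m) := by
    rw [singleZeroRingHom_eq, single_mul_single, add_zero, one_mul]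
  rw [this]
  exact Ideal.mul_mem_left _ _ (Ideal.mem_map_of_mem _ (hx m))

/-- The **shear** endomorphism `a [m] ↦ ρ(a) · [m]` of `A[M]` attached to a ring map
`ρ : A → A[M]` (Mathlib's `liftNCRingHom ρ (of A M)`) on a monomial. [folklore] -/
theorem liftNCRingHom_of_single (ρ : A →+* A[M]) (hc) (m : M) (a : A) :
    liftNCRingHom ρ (AddMonoidAlgebra.of A M) hc (single m a) = ρ a * single m 1 := by
  simp [liftNCRingHom_single, AddMonoidAlgebra.of_apply]

end MonoidAlgebra

section Coaction

variable {M A σ : Type*} [DecidableEq M] [AddCommGroup M] [CommRing A] [SetLike σ A]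
  [AddSubgroupClass σ A] (𝒜 : M → σ) [GradedRing 𝒜]

/-- **The coaction of a grading.** For a ring `A` graded by the abelian group `M` there is a ring
map `ρ : A → A[M]` with `ρ a = a [i]` for homogeneous `a ∈ 𝒜 i` (so `ρ a = Σ_χ a_χ [χ]`): the
decomposition `A ≃ ⨁ᵢ 𝒜 i` followed by `(aᵢ)ᵢ ↦ Σ aᵢ [i]`, multiplicative because
`𝒜 i · 𝒜 j ⊆ 𝒜 (i + j)`. Geometrically: the action `𝔾(M) × Spec A → Spec A` of the
diagonalizable group with character group `M`. [folklore] -/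
theorem exists_coaction : ∃ ρ : A →+* A[M], ∀ (i : M) (a : A), a ∈ 𝒜 i → ρ a = single i a := by
  refine ⟨(DirectSum.toSemiring
      (fun i => (singleAddHom i).comp (AddSubmonoidClass.subtype (𝒜 i)))
      (by simp [SetLike.coe_gOne, AddMonoidAlgebra.one_def])
      (fun ai aj => by simp [SetLike.coe_gMul, single_mul_single])).comp
    (decomposeRingEquiv 𝒜).toRingHom, fun i a h => ?_⟩
  simp only [RingHom.coe_comp, Function.comp_apply, RingEquiv.toRingHom_eq_coe,
    RingEquiv.coe_toRingHom]
  change DirectSum.toSemiring _ _ _ (decompose 𝒜 a) = _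
  rw [decompose_of_mem 𝒜 h, toSemiring_of]
  rfl

/-- Shears compose to the identity: if `ρ₂` has the opposite weights of `ρ₁` on `𝒜`
(`ε₂ i + ε₁ i = 0`), the shear by `ρ₂` undoes the shear by `ρ₁`. [folklore] -/
theorem liftNCRingHom_comp_liftNCRingHom {ρ₁ ρ₂ : A →+* A[M]} {ε₁ ε₂ : M → M}
    (h₁ : ∀ (i : M) (a : A), a ∈ 𝒜 i → ρ₁ a = single (ε₁ i) a)
    (h₂ : ∀ (i : M) (a : A), a ∈ 𝒜 i → ρ₂ a = single (ε₂ i) a) (hε : ∀ i, ε₂ i + ε₁ i = 0)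
    (c₁ c₂) :
    (liftNCRingHom ρ₂ (AddMonoidAlgebra.of A M) c₂).comp
      (liftNCRingHom ρ₁ (AddMonoidAlgebra.of A M) c₁) = RingHom.id _ := by
  classical
  refine AddMonoidAlgebra.ringHom_ext (fun b => ?_) (fun m => ?_)
  · rw [RingHom.comp_apply, RingHom.id_apply, liftNCRingHom_of_single,
      ← AddMonoidAlgebra.one_def, mul_one]
    conv_lhs => rw [← sum_support_decompose 𝒜 b]
    conv_rhs => rw [← sum_support_decompose 𝒜 b]
    rw [map_sum, map_sum, ← sum_single_zero]
    refine Finset.sum_congr rfl fun i _ => ?_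
    rw [h₁ i _ (decompose 𝒜 b i).2, liftNCRingHom_of_single, h₂ i _ (decompose 𝒜 b i).2,
      single_mul_single, hε, mul_one]
  · rw [RingHom.comp_apply, RingHom.id_apply, liftNCRingHom_of_single, map_one, one_mul,
      liftNCRingHom_of_single, map_one, one_mul]

variable (ρ : A →+* A[M]) (hρ : ∀ (i : M) (a : A), a ∈ 𝒜 i → ρ a = single i a)
include hρ

/-- The coefficients of the coaction are the homogeneous components: `(ρ a)_i = a_i`.
[folklore] -/
theorem coeff_coaction (a : A) (i : M) : (ρ a).coeff i = decompose 𝒜 a i := by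
  induction a using Decomposition.inductionOn 𝒜 with
  | zero => simp
  | @homogeneous j x =>
    rw [hρ j x x.2, coeff_single]
    obtain rfl | h := eq_or_ne j i
    · rw [Finsupp.single_eq_same, decompose_of_mem_same 𝒜 x.2]
    · rw [Finsupp.single_eq_of_ne (Ne.symm h), decompose_of_mem_ne 𝒜 x.2 h]
  | add a b ha hb => simp [ha, hb]

/-- **A homogeneous ideal extends to a coaction-stable ideal**: if `J ≤ A` is homogeneous then
`ρ(J) · A[M] = J · A[M]` — for `a ∈ 𝒜 i`, `ρ a = a [i]` is a unit multiple of `ι₀ a = a [0]`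
(the closed subscheme `V(J)` is torus-stable). [folklore] -/
theorem map_coaction_eq_of_isHomogeneous {J : Ideal A} (hJ : J.IsHomogeneous 𝒜) :
    J.map ρ = J.map singleZeroRingHom := by
  apply le_antisymm
  · rw [Ideal.map_le_iff_le_comap]
    intro a ha
    exact mem_map_of_coeff_mem fun m => by rw [coeff_coaction 𝒜 ρ hρ]; exact hJ m ha
  · rw [Ideal.map_le_iff_le_comap]
    intro a ha
    rw [Ideal.mem_comap]
    classical
    rw [← sum_support_decompose 𝒜 a, map_sum]
    refine Ideal.sum_mem _ fun i _ => ?_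
    have : singleZeroRingHom (decompose 𝒜 a i : A) =
        single (-i) (1 : A) * ρ (decompose 𝒜 a i : A) := by
      rw [hρ i _ (decompose 𝒜 a i).2, singleZeroRingHom_eq, single_mul_single, neg_add_cancel,
        one_mul]
    rw [this]
    exact Ideal.mul_mem_left _ _ (Ideal.mem_map_of_mem _ (hJ i ha))

/-- **Coaction-stability forces homogeneity**: if `ρ(J) · A[M] ≤ J · A[M]` then `J` is
homogeneous — for `a ∈ J` the coefficients `a_i` of `ρ a ∈ J · A[M]` lie in `J`. [folklore] -/
theorem isHomogeneous_of_map_coaction_le {J : Ideal A}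
    (h : J.map ρ ≤ J.map singleZeroRingHom) : J.IsHomogeneous 𝒜 := by
  intro i a ha
  rw [← coeff_coaction 𝒜 ρ hρ]
  exact coeff_mem_of_mem_map (h (Ideal.mem_map_of_mem _ ha)) i

/-- **The coaction is the inclusion followed by an automorphism**: the shear
`a [m] ↦ ρ(a) [m]` of `A[M]` is a ring automorphism (inverse: the shear by the antipode-twisted
coaction `a ↦ Σ a_χ [-χ]`) whose composite with `ι₀` is `ρ`. [folklore] -/
theorem exists_ringEquiv_comp_eq_coaction :
    ∃ e : A[M] ≃+* A[M], e.toRingHom.comp singleZeroRingHom = ρ := by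
  let ρ' : A →+* A[M] := (mapDomainRingHom A (negAddMonoidHom : M →+ M)).comp ρ
  have hρ' : ∀ (i : M) (a : A), a ∈ 𝒜 i → ρ' a = single (-i) a := fun i a h => by
    simp [ρ', hρ i a h, mapDomain_single]
  have hρ₁ : ∀ (i : M) (a : A), a ∈ 𝒜 i → ρ a = single (id i) a := hρ
  let σ₁ : A[M] →+* A[M] := liftNCRingHom ρ (AddMonoidAlgebra.of A M) fun _ _ => Commute.all _ _
  let σ₂ : A[M] →+* A[M] := liftNCRingHom ρ' (AddMonoidAlgebra.of A M) fun _ _ => Commute.all _ _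
  refine ⟨RingEquiv.ofRingHom σ₁ σ₂
    (liftNCRingHom_comp_liftNCRingHom 𝒜 hρ' hρ₁ (fun i => by simp) _ _)
    (liftNCRingHom_comp_liftNCRingHom 𝒜 hρ₁ hρ' (fun i => by simp) _ _), ?_⟩
  ext b : 1
  change σ₁ (single 0 b) = ρ b
  rw [liftNCRingHom_of_single, ← AddMonoidAlgebra.one_def, mul_one]

end Coaction

/-! ## Smoothness of the torus chart and of the coaction -/

section Smooth

variable (A : Type*) [CommRing A]

open Polynomial in
/-- **Laurent polynomial rings are smooth**: `A[T, T⁻¹]` is the localisation of the smooth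
`A`-algebra `A[T]` away from `T`. [folklore] -/
theorem smooth_laurentPolynomial : Algebra.Smooth A (LaurentPolynomial A) := by
  haveI : Algebra.Smooth A A[X] := {}
  haveI : Algebra.Smooth A[X] (LaurentPolynomial A) :=
    Algebra.Smooth.of_isLocalization_Away (X : A[X])
  haveI : IsScalarTower A A[X] (LaurentPolynomial A) := IsScalarTower.of_algebraMap_eq fun a => by
    rw [LaurentPolynomial.algebraMap_eq_toLaurent, Polynomial.algebraMap_eq, Polynomial.toLaurent_C,
      LaurentPolynomial.C_eq_algebraMap]
  exact Algebra.Smooth.comp A A[X] (LaurentPolynomial A)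

/-- **The coordinate ring `A[ℤʲ]` of the split torus `𝔾ₘʲ` is a smooth `A`-algebra**: by
induction on `j`, `A[ℤʲ⁺¹] ≅ (A[ℤʲ])[T, T⁻¹]` (`curryAlgEquiv`). [folklore] -/
theorem smooth_addMonoidAlgebra_pi : ∀ j : ℕ, Algebra.Smooth A A[Fin j → ℤ]
  | 0 =>
    haveI : Algebra.Smooth A A := {}
    Algebra.Smooth.of_equiv (AddMonoidAlgebra.uniqueAlgEquiv A (A := A) (Fin 0 → ℤ)).symm
  | j + 1 => by
    haveI := smooth_addMonoidAlgebra_pi j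
    haveI : Algebra.Smooth A[Fin j → ℤ] (LaurentPolynomial A[Fin j → ℤ]) :=
      smooth_laurentPolynomial _
    haveI : Algebra.Smooth A (LaurentPolynomial A[Fin j → ℤ]) :=
      Algebra.Smooth.comp A A[Fin j → ℤ] _
    exact Algebra.Smooth.of_equiv
      ((AddMonoidAlgebra.domCongr A A
          (Fin.consLinearEquiv ℤ (fun _ : Fin (j + 1) => ℤ)).symm.toAddEquiv).trans
        (AddMonoidAlgebra.curryAlgEquiv A)).symm

/-- The inclusion `ι₀ : A → A[ℤʲ]` (projection of the torus chart) is a smooth ring map.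
[folklore] -/
theorem smooth_singleZeroRingHom (j : ℕ) : (singleZeroRingHom : A →+* A[Fin j → ℤ]).Smooth := by
  rw [← show (algebraMap A A[Fin j → ℤ]) = singleZeroRingHom from RingHom.ext fun _ => rfl,
    RingHom.smooth_algebraMap]
  exact smooth_addMonoidAlgebra_pi A j

variable {A}

/-- **The coaction of a `ℤʲ`-grading is a smooth ring map** `A → A[ℤʲ]` (the action map of the
torus chart is smooth): it is `ι₀` followed by a ring automorphism. [folklore] -/
theorem smooth_coaction {σ : Type*} [SetLike σ A] [AddSubgroupClass σ A] {j : ℕ}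
    (𝒜 : (Fin j → ℤ) → σ) [GradedRing 𝒜] (ρ : A →+* A[Fin j → ℤ])
    (hρ : ∀ (i : Fin j → ℤ) (a : A), a ∈ 𝒜 i → ρ a = single i a) : ρ.Smooth := by
  obtain ⟨e, he⟩ := exists_ringEquiv_comp_eq_coaction 𝒜 ρ hρ
  rw [← he]
  exact RingHom.Smooth.comp (smooth_singleZeroRingHom A j) (RingHom.Smooth.of_bijective e.bijective)

end Smooth

end Summit.ResolutionOfSingularities.ResolutionOfSingularities.Theorems.DatumToEmbedded.CentreHomogeneous
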